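import Summits.CriticalPhenomena.SAWScalingLimit.Theorems.SAWTotalPositivityCriticalBubbleBoundJoinSurgeryDefs
import Summits.CriticalPhenomena.SAWScalingLimit.Theorems.SAWTotalPositivityCriticalBubbleBoundDockingEntropyZero

/-!
# First contact and the window of the Madras join
(line `docking-census-joining`, stub `contact_window_facts`)

Crux `stmt-CriticalPhenomena-7117`
(`Summit.CriticalPhenomena.SAWScalingLimit.Theses.SAWTotalPositivity.CriticalBubbleBound`), line
`docking-census-joining` (lead c6, JOIN-MASS programme, wave 2), registered stub
`contact_window_facts` of the lead's skeleton: the FIRST-CONTACT geometry of the Madras join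
(objects `contactDiffs`, `contactT`, `cands`, `centres`, `winY`, `sigmaShift`, `joinY`, `offsets` of
`…Theorems.SAWTotalPositivityCriticalBubbleBoundJoinSurgeryDefs`; `verts`, `shift` of
`…Theorems.SAWTotalPositivityCriticalBubbleBoundDockingDefs`; `lexRooted`, `tipRow`, `ymax` of
`…Theorems.SAWTotalPositivityCriticalBubbleBoundJoinDefs`).

**Setting.** `τ = P(χ¹)` with vertex set `A = verts j χ¹`; the partner `P(χ²)` (lex-rooted, all
ordinates `≥ 0`) raised by an admissible offset `k ∈ offsets j m χ¹ χ²`, vertex set `B = V(χ²) + k e₁`;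
`T* = contactT A B`, the LARGEST horizontal translate at which some `a ∈ A`, `b ∈ B + T* e₀` lie in
one column at vertical distance `≤ 2`; `σ' = χ² + (T*, k)` with vertex set `B'`; and the window
`Y = joinY = winY A B'`, the lexicographically largest site whose vertical 3-window meets `A` and `B'`.

**Statement / proof** (`contact_window_facts`).
* `sigmaShift … 1 = k` — by definition;
* FREE ZONES (maximality of `T*`): no vertex of `A` lies `s ≥ 1` columns to the right of a vertex of
  `B'` within two rows, and no vertex of `B'` lies `s ≥ 1` columns to the left of a vertex of `A`
  within two rows — otherwise `T* + s` would be a contact translate (`contactT_mem`);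
* CONTACT OCCURS: `k ≤ tipRow τ ≤ k + ymax χ²` (`mem_offsets`), and the nearest-neighbour walk `χ²`
  from the origin visits every row between `0` and `ymax χ²` (discrete intermediate values,
  `exists_apply_one_eq_of_le`), so `B'` has a vertex on the tip row of `τ`; with the tip vertex of
  `τ` this is a pair at vertical distance `0`, so `contactDiffs A B ≠ ∅`, `T*` is a contact translate,
  the contact pair spans a window centre, and `winY_spec` yields the window clauses (the 3-window of
  `Y` meets `A` and `B'`, `mem_cands_iff`; lex-maximality of `Y` among the centres);
* all rows of `B'` are `≥ k` (ordinates of `χ²` are `≥ 0`, `apply_one_nonneg_of_mem_lexRooted`).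

Sources: N. Madras, J. Statist. Phys. 78 (1995) 681–699 (the joining procedure, via Hammond);
A. Hammond, Ann. Probab. 46 (2018) = arXiv:1808.09032, §4.1. Elementary lattice combinatorics
([folklore]).
-/

noncomputable section

open Literature.Probability.LatticeModels
open Literature.Probability.RandomPlanarGeometry Literature.Probability.RandomPlanarGeometry.SAW
open scoped BigOperators
open Summit.CriticalPhenomena.SAWScalingLimit.Theorems.CriticalBubbleBound.Negative (e₀)
open Summit.CriticalPhenomena.SAWScalingLimit.Theorems.CriticalBubbleBound.Docking

namespace Summit.CriticalPhenomena.SAWScalingLimit.Theorems.CriticalBubbleBound.Join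

/-! ## Coordinates on `ℤ²` -/

/-- Two sites of `ℤ²` are equal iff both coordinates agree. [folklore] -/
private theorem site_eq_iff {x y : Site 2} : x = y ↔ x 0 = y 0 ∧ x 1 = y 1 := by
  constructor
  · rintro rfl
    exact ⟨rfl, rfl⟩
  · rintro ⟨h0, h1⟩
    funext i
    fin_cases i
    · simpa using h0
    · simpa using h1

/-- Coordinates of `x + (s, t)`. [folklore] -/
private theorem add_vec_apply (x : Site 2) (s t : ℤ) :
    (x + ![s, t]) 0 = x 0 + s ∧ (x + ![s, t]) 1 = x 1 + t := ⟨rfl, rfl⟩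

/-- A nearest-neighbour step raises the ordinate by at most one. [folklore] -/
private theorem apply_one_le_of_adj {a x : Site 2} (h : (zdGraph 2).Adj a x) : x 1 ≤ a 1 + 1 := by
  have he0 : e₀ (1 : Fin 2) = 0 := rfl
  have he1 : e₁ (1 : Fin 2) = 1 := rfl
  have hadd : ∀ p q : Site 2, (p + q) 1 = p 1 + q 1 := fun _ _ => rfl
  have hsub : ∀ p q : Site 2, (p - q) 1 = p 1 - q 1 := fun _ _ => rfl
  rcases adj_cases h with rfl | rfl | rfl | rfl
  · have h' := hadd a e₀
    omega
  · have h' := hsub a e₀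
    omega
  · have h' := hadd a e₁
    omega
  · have h' := hsub a e₁
    omega

/-! ## Discrete intermediate values along a lattice walk -/

/-- DISCRETE INTERMEDIATE VALUES: a nearest-neighbour walk `χ` of `ℤ²` started at the origin has
visited, by time `n`, every row between `0` and the ordinate of `χ n`. [folklore] -/
theorem exists_apply_one_eq_of_le {m : ℕ} {χ : ℕ → Site 2} (hχ : χ ∈ Zd.sawFun 2 m e₀) :
    ∀ n ≤ m, ∀ r : ℤ, 0 ≤ r → r ≤ χ n 1 → ∃ i ≤ n, χ i 1 = r := by
  obtain ⟨h0, -, hadj, -⟩ := Zd.mem_sawFun.1 hχ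
  intro n
  induction n with
  | zero =>
    intro _ r hr0 hr
    refine ⟨0, le_rfl, ?_⟩
    rw [h0] at hr ⊢
    simp only [Pi.zero_apply] at hr ⊢
    omega
  | succ n ih =>
    intro hn r hr0 hr
    by_cases heq : χ (n + 1) 1 = r
    · exact ⟨n + 1, le_rfl, heq⟩
    · have hstep := apply_one_le_of_adj (hadj n (by omega))
      obtain ⟨i, hi, hir⟩ := ih (by omega) r hr0 (by omega)
      exact ⟨i, by omega, hir⟩

/-! ## Membership lemmas -/

/-- Vertices of a walk: `a ∈ verts n χ ↔ χ i = a` for some `i ≤ n`. [folklore] -/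
theorem mem_verts_iff {n : ℕ} {χ : ℕ → Site 2} {a : Site 2} :
    a ∈ verts n χ ↔ ∃ i ≤ n, χ i = a := by
  constructor
  · intro h
    obtain ⟨i, hi, hia⟩ := Finset.mem_image.1 h
    exact ⟨i, Nat.lt_succ_iff.1 (Finset.mem_range.1 hi), hia⟩
  · rintro ⟨i, hi, hia⟩
    exact Finset.mem_image.2 ⟨i, Finset.mem_range.2 (Nat.lt_succ_of_le hi), hia⟩

/-- Vertices of a translate: `b ∈ verts n (shift v χ) ↔ χ i + v = b` for some `i ≤ n`
(`verts n (shift v χ)` is `verts n χ` translated by `v`). [folklore] -/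
theorem mem_verts_shift_iff {n : ℕ} {v : Site 2} {χ : ℕ → Site 2} {b : Site 2} :
    b ∈ verts n (shift v χ) ↔ ∃ i ≤ n, χ i + v = b := by
  simp only [mem_verts_iff, shift_eval]

/-- Membership in `contactDiffs`: the contact translates are the column differences `a 0 - b 0`
of pairs `a ∈ A`, `b ∈ B` at vertical distance `≤ 2`. [folklore] -/
theorem mem_contactDiffs {A B : Finset (Site 2)} {T : ℤ} :
    T ∈ contactDiffs A B ↔ ∃ a ∈ A, ∃ b ∈ B, |a 1 - b 1| ≤ 2 ∧ a 0 - b 0 = T := by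
  unfold contactDiffs
  constructor
  · intro h
    obtain ⟨p, hp, hpT⟩ := Finset.mem_image.1 h
    obtain ⟨hp1, hp2⟩ := Finset.mem_filter.1 hp
    obtain ⟨ha, hb⟩ := Finset.mem_product.1 hp1
    exact ⟨p.1, ha, p.2, hb, hp2, hpT⟩
  · rintro ⟨a, ha, b, hb, hab, h⟩
    exact Finset.mem_image.2 ⟨(a, b), Finset.mem_filter.2 ⟨Finset.mem_product.2 ⟨ha, hb⟩, hab⟩, h⟩

/-- Membership in `cands V`: the vertical 3-window `{z - e₁, z, z + e₁}` of `z` meets `V`, i.e.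
`z + (0, t) ∈ V` for some `|t| ≤ 1`. [folklore] -/
theorem mem_cands_iff {V : Finset (Site 2)} {z : Site 2} :
    z ∈ cands V ↔ ∃ t : ℤ, -1 ≤ t ∧ t ≤ 1 ∧ z + ![0, t] ∈ V := by
  unfold cands
  rw [Finset.mem_biUnion]
  constructor
  · rintro ⟨v, hv, hz⟩
    rw [Finset.mem_insert, Finset.mem_insert, Finset.mem_singleton] at hz
    have key : ∃ t : ℤ, -1 ≤ t ∧ t ≤ 1 ∧ z + ![0, t] = v := by
      rcases hz with rfl | rfl | rfl
      · refine ⟨1, by norm_num, le_rfl, ?_⟩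
        rw [site_eq_iff]
        simp only [e₁, Pi.add_apply, Pi.sub_apply, Matrix.cons_val_zero, Matrix.cons_val_one]
        omega
      · refine ⟨0, by norm_num, by norm_num, ?_⟩
        rw [site_eq_iff]
        simp only [Pi.add_apply, Matrix.cons_val_zero, Matrix.cons_val_one]
        omega
      · refine ⟨-1, le_rfl, by norm_num, ?_⟩
        rw [site_eq_iff]
        simp only [e₁, Pi.add_apply, Matrix.cons_val_zero, Matrix.cons_val_one]
        omega
    obtain ⟨t, ht1, ht2, htv⟩ := key
    exact ⟨t, ht1, ht2, by rw [htv]; exact hv⟩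
  · rintro ⟨t, ht1, ht2, hv⟩
    refine ⟨_, hv, ?_⟩
    rw [Finset.mem_insert, Finset.mem_insert, Finset.mem_singleton, site_eq_iff, site_eq_iff,
      site_eq_iff]
    simp only [e₁, Pi.add_apply, Pi.sub_apply, Matrix.cons_val_zero, Matrix.cons_val_one]
    omega

/-! ## The stub -/

/-- **Stub `contact_window_facts` (first-contact geometry of the Madras join).** For lex-rooted
classes `χ¹ ∈ lexRooted j`, `χ² ∈ lexRooted m` and an admissible offset `k`, with `σ' = χ² + (T*, k)`
the partner at first contact (vertex set `B'`) and `Y = joinY` the window: `sigmaShift … 1 = k`; the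
strip of columns to the right of any vertex of `B'` (two rows up and down) is free of `A = V(χ¹)` and
the strip to the left of any vertex of `A` is free of `B'` (maximality of the first-contact translate);
the vertical 3-window of `Y` meets `A` and `B'`, and `Y` is lexicographically maximal among such
window centres; every vertex of `B'` lies on a row `≥ k`; and `B'` has a vertex on the tip row of
`P(χ¹)` (discrete intermediate values along `χ²`). [cite: Hammond2015SAPJoining, §4.1 (Madras' joining procedure: first contact, the window Y)] -/
theorem contact_window_facts : ∀ (j m : ℕ) (χ₁ χ₂ : ℕ → Site 2) (k : ℤ), χ₁ ∈ lexRooted j → χ₂ ∈ lexRooted m → 3 ≤ j → 3 ≤ m → k ∈ offsets j m χ₁ χ₂ → (sigmaShift j m χ₁ χ₂ k) 1 = k ∧ (∀ b ∈ verts m (shift (sigmaShift j m χ₁ χ₂ k) χ₂), ∀ s t : ℤ, 1 ≤ s → -2 ≤ t → t ≤ 2 → b + ![s, t] ∉ verts j χ₁) ∧ (∀ a ∈ verts j χ₁, ∀ s t : ℤ, 1 ≤ s → -2 ≤ t → t ≤ 2 → a + ![-s, t] ∉ verts m (shift (sigmaShift j m χ₁ χ₂ k) χ₂)) ∧ (∃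 t : ℤ, -1 ≤ t ∧ t ≤ 1 ∧ joinY j m χ₁ χ₂ k + ![0, t] ∈ verts j χ₁) ∧ (∃ t : ℤ, -1 ≤ t ∧ t ≤ 1 ∧ joinY j m χ₁ χ₂ k + ![0, t] ∈ verts m (shift (sigmaShift j m χ₁ χ₂ k) χ₂)) ∧ (∀ w ∈ centres (verts j χ₁) (verts m (shift (sigmaShift j m χ₁ χ₂ k) χ₂)), w 1 < joinY j m χ₁ χ₂ k 1 ∨ (w 1 = joinY j m χ₁ χ₂ k 1 ∧ w 0 ≤ joinY j m χ₁ χ₂ k 0)) ∧ (∀ b ∈ verts m (shift (sigmaShift j m χ₁ χ₂ k) χ₂), k ≤ b 1) ∧ (∃ b ∈ verts m (shift (sigmaShift j m χ₁ χ₂ k) χ₂), b 1 = tipRow j χ₁) := by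
  intro j m χ₁ χ₂ k _ hχ₂ _ _ hk
  obtain ⟨-, hlo, hhi⟩ := mem_offsets.1 hk
  have hJ : joinY j m χ₁ χ₂ k =
      winY (verts j χ₁) (verts m (shift (sigmaShift j m χ₁ χ₂ k) χ₂)) := rfl
  rw [hJ]
  -- abbreviations: `σ = (T*, k)`, `A = V(τ)`, `B' = V(σ')`, `B = V(χ²) + k e₁`
  set σ : Site 2 := sigmaShift j m χ₁ χ₂ k
  set A : Finset (Site 2) := verts j χ₁
  set B' : Finset (Site 2) := verts m (shift σ χ₂)
  set B : Finset (Site 2) := (verts m χ₂).image fun p => p + ![0, k]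
  have hσ0 : σ 0 = contactT A B := rfl
  have hσ1 : σ 1 = k := rfl
  -- vertices of `B'` in coordinates
  have hB'c : ∀ b ∈ B', ∃ i ≤ m, b 0 = χ₂ i 0 + contactT A B ∧ b 1 = χ₂ i 1 + k := by
    intro b hb
    obtain ⟨i, hi, rfl⟩ := mem_verts_shift_iff.1 hb
    exact ⟨i, hi, by rw [Pi.add_apply, hσ0], by rw [Pi.add_apply, hσ1]⟩
  -- a same-column pair at vertical distance `≤ 2` is a contact pair: its column difference is a
  -- contact translate, hence at most the first-contact translate `T*`
  have hmem : ∀ a ∈ A, ∀ i ≤ m, -2 ≤ a 1 - (χ₂ i 1 + k) → a 1 - (χ₂ i 1 + k) ≤ 2 →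
      a 0 - χ₂ i 0 ∈ contactDiffs A B := by
    intro a ha i hi h1 h2
    have hc := add_vec_apply (χ₂ i) 0 k
    have hBi : χ₂ i + ![0, k] ∈ B :=
      Finset.mem_image_of_mem (fun p => p + ![0, k]) (apply_mem_verts χ₂ hi)
    refine mem_contactDiffs.2 ⟨a, ha, χ₂ i + ![0, k], hBi, ?_, by omega⟩
    rw [abs_le]
    omega
  have hmax : ∀ a ∈ A, ∀ i ≤ m, -2 ≤ a 1 - (χ₂ i 1 + k) → a 1 - (χ₂ i 1 + k) ≤ 2 →
      a 0 - χ₂ i 0 ≤ contactT A B := fun a ha i hi h1 h2 =>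
    (contactT_mem ⟨_, hmem a ha i hi h1 h2⟩).2 _ (hmem a ha i hi h1 h2)
  -- FREE ZONES
  have h2 : ∀ b ∈ B', ∀ s t : ℤ, 1 ≤ s → -2 ≤ t → t ≤ 2 → b + ![s, t] ∉ A := by
    intro b hb s t hs ht1 ht2 ha
    obtain ⟨i, hi, hb0, hb1⟩ := hB'c b hb
    have hc := add_vec_apply b s t
    have key := hmax _ ha i hi (by omega) (by omega)
    omega
  have h3 : ∀ a ∈ A, ∀ s t : ℤ, 1 ≤ s → -2 ≤ t → t ≤ 2 → a + ![-s, t] ∉ B' := by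
    intro a ha s t hs ht1 ht2 hb
    obtain ⟨i, hi, hb0, hb1⟩ := hB'c _ hb
    have hc := add_vec_apply a (-s) t
    have key := hmax a ha i hi (by omega) (by omega)
    omega
  -- ROWS OF `B'`
  have h4 : ∀ b ∈ B', k ≤ b 1 := by
    intro b hb
    obtain ⟨i, hi, -, hb1⟩ := hB'c b hb
    have h0i := apply_one_nonneg_of_mem_lexRooted hχ₂ hi
    omega
  -- a vertex of `B'` on the tip row of `τ` (discrete intermediate values along `χ²`)
  obtain ⟨i₀, hi₀, hymax⟩ := exists_apply_eq_ymax m χ₂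
  obtain ⟨i, hi, hir⟩ := exists_apply_one_eq_of_le (lexRooted_subset m hχ₂) i₀ hi₀
    (tipRow j χ₁ - k) (by omega) (by omega)
  have him : i ≤ m := hi.trans hi₀
  have htB' : χ₂ i + σ ∈ B' := mem_verts_shift_iff.2 ⟨i, him, rfl⟩
  have ht1 : (χ₂ i + σ) 1 = tipRow j χ₁ := by
    rw [Pi.add_apply, hσ1]
    omega
  -- CONTACT OCCURS: the tip vertex of `τ` and `χ² i + σ` lie on one row
  obtain ⟨a₀, ha₀, ha₀1⟩ := exists_eq_tipRow j χ₁
  have hne : (contactDiffs A B).Nonempty :=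
    ⟨a₀ 0 - χ₂ i 0, hmem a₀ (mem_rightCol.1 ha₀).1 i him (by omega) (by omega)⟩
  obtain ⟨a, haA, b, hbB, hab, habT⟩ := mem_contactDiffs.1 (contactT_mem hne).1
  obtain ⟨v, hv, hvb⟩ := Finset.mem_image.1 hbB
  obtain ⟨i', hi', rfl⟩ := mem_verts_iff.1 hv
  have hvb' : χ₂ i' + ![0, k] = b := hvb
  subst hvb'
  have hc' := add_vec_apply (χ₂ i') 0 k
  rw [abs_le] at hab
  -- the contact pair `a`, `χ² i' + σ` (one column, vertical distance `≤ 2`) spans a window centre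
  have hb' : χ₂ i' + σ ∈ B' := mem_verts_shift_iff.2 ⟨i', hi', rfl⟩
  obtain ⟨c, hca, hcb⟩ : ∃ c : ℤ, (-1 ≤ a 1 - c ∧ a 1 - c ≤ 1) ∧
      (-1 ≤ χ₂ i' 1 + k - c ∧ χ₂ i' 1 + k - c ≤ 1) :=
    ⟨(a 1 + (χ₂ i' 1 + k)) / 2, by omega, by omega⟩
  have hcen : (centres A B').Nonempty := by
    refine ⟨![a 0, c], ?_⟩
    rw [centres, Finset.mem_inter, mem_cands_iff, mem_cands_iff]
    refine ⟨⟨a 1 - c, hca.1, hca.2, ?_⟩, ⟨χ₂ i' 1 + k - c, hcb.1, hcb.2, ?_⟩⟩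
    · convert haA using 1
      rw [site_eq_iff]
      simp only [Pi.add_apply, Matrix.cons_val_zero, Matrix.cons_val_one]
      omega
    · convert hb' using 1
      rw [site_eq_iff]
      simp only [Pi.add_apply, Matrix.cons_val_zero, Matrix.cons_val_one, hσ0, hσ1]
      omega
  -- THE WINDOW
  obtain ⟨hYmem, hYmax⟩ := winY_spec hcen
  rw [centres, Finset.mem_inter, mem_cands_iff, mem_cands_iff] at hYmem
  exact ⟨hσ1, h2, h3, hYmem.1, hYmem.2, hYmax, h4, χ₂ i + σ, htB', ht1⟩

end Summit.CriticalPhenomena.SAWScalingLimit.Theorems.CriticalBubbleBound.Join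

end
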